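import Summits.QuantumFields.YangMills.Theorems.LuscherReductionTwistedTraceScalingBOCentralQuasimode
import Summits.QuantumFields.YangMills.Theorems.LuscherReductionTwistedTraceScalingBOCentralRatesSix
import Summits.QuantumFields.YangMills.Theorems.LuscherReductionTwistedTraceScalingBOCoreDefectInner
import HarnessLib

/-!
# (B-O) ★★★ the CORE DEFECT OF RECORD (schedule B) for signed slow amplitudes

`…BOCoreDefectInner.core_transfer_defect_le_inner` instantiated on schedule B with the central quasimode
`…BOCentralQuasimode.central_quasimode_record` (`P = M`, `η_c = η`) and the slow-window transport rate
`…BOCentralRatesSix.tendsto_coreExp_schedule_delta`: for every `η > 0`, eventually in `β`, for every slow-window input point `u'`,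
every inner-core fibre direction `v'` and every bounded measurable amplitude `φ` supported in the slow window
(`‖q(u_k) − 1‖ ≤ β^{-1/3}`, `L³S(u) ≤ β^{-1/3}`),
`|∫ φ(u)·I(u) du − c₁(β)M(v')·∫ φ ρ̃| ≤ 2η·(c₁(β)M(v')·∫ |φ| ρ̃)`, `ρ̃(u) = K̃₁(u',u)/K₁(1,1)`,
`I(u) = ∫ T_{Ω_c,W}(c⁻¹·orthoTube(u',v')·c, u) dc` — step (C4)-core of COARSE-DESIGN §27.7 with the explicit rate `2η`, `η ↓ 0`.
-/

open MeasureTheory Filter Topology Real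
open scoped BigOperators RealInnerProductSpace
open Literature.MathematicalPhysics.QuantumFieldTheory
open Literature.MathematicalPhysics.QuantumLattice

namespace Summit.QuantumFields.YangMills.Theorems.FemtoTransferGap.TwoLattice.ConstTube

open Summit.QuantumFields.YangMills.Theorems.FemtoTransferGap
open Summit.QuantumFields.YangMills.Theorems.FemtoTransferGap.TwoLattice
open Summit.QuantumFields.YangMills.Theorems.FemtoTransferGap.TwoLattice.Avg
open Summit.QuantumFields.YangMills.Theorems.FemtoTransferGap.TwoLattice.Stiff
open Summit.QuantumFields.YangMills.Theorems.FemtoTransferGap.TwoLattice.GnChart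

variable {L : ℕ} [NeZero L]

/-- The defect factor `max(1 − e^{-X'}(1−η), e^{X'}(1+η) − 1) ≤ 2η` eventually (`X' → 0` by `tendsto_coreExp_schedule_delta`). [folklore] -/
theorem eventually_defectFactor_le {η : ℝ} (hη : 0 < η) :
    ∀ᶠ β : ℝ in atTop, max (1 - Real.exp (-(coreEta L β (powScale (1 / 3) β) ((powScale (1 / 3) β) + (powScale (1 / 3) β)) (9 * (L : ℝ) * (5 * (powScale (1 / 2) β * btLog β ^ 2)) + (powScale 1 β)) (min (1 / 40) (powScale (1 / 2) β * btLog β)) (powScale 1 β * Fintype.card (Site 3 L)) (powScale (1 / 3) β) + coreEps1 L β (powScale (1 / 3) β) (9 * (L : ℝ) * (5 * (powScale (1 / 2) β * btLog β ^ 2)) + (powScale 1 β)) (min (1 / 40) (powScale (1 / 2) β * btLog β)) + coreEps2 L β (powScale (1 / 3) β) (9 * (L : ℝ) * (5 * (powScale (1 / 2) β * btLog β ^ 2)) + (powScale 1 β)) (min (1 / 40) (powScale (1 / 2) β * btLog β)) (powScale (1 / 3) β))) * (1 - η)) (Real.exp (coreEta L β (powScale (1 / 3) β) ((powScale (1 /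 3) β) + (powScale (1 / 3) β)) (9 * (L : ℝ) * (5 * (powScale (1 / 2) β * btLog β ^ 2)) + (powScale 1 β)) (min (1 / 40) (powScale (1 / 2) β * btLog β)) (powScale 1 β * Fintype.card (Site 3 L)) (powScale (1 / 3) β) + coreEps1 L β (powScale (1 / 3) β) (9 * (L : ℝ) * (5 * (powScale (1 / 2) β * btLog β ^ 2)) + (powScale 1 β)) (min (1 / 40) (powScale (1 / 2) β * btLog β)) + coreEps2 L β (powScale (1 / 3) β) (9 * (L : ℝ) * (5 * (powScale (1 / 2) β * btLog β ^ 2)) + (powScale 1 β)) (min (1 / 40) (powScale (1 / 2) β * btLog β)) (powScale (1 / 3) β)) * (1 + η) - 1) ≤ 2 * η := by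
  have tX := tendsto_coreExp_schedule_delta (L := L)
  have e1 := tendsto_exp_neg_one_of_tendsto_zero tX
  have e2 := tendsto_exp_one_of_tendsto_zero tX
  have h1 : Tendsto (fun β : ℝ => 1 - Real.exp (-(coreEta L β (powScale (1 / 3) β) ((powScale (1 / 3) β) + (powScale (1 / 3) β)) (9 * (L : ℝ) * (5 * (powScale (1 / 2) β * btLog β ^ 2)) + (powScale 1 β)) (min (1 / 40) (powScale (1 / 2) β * btLog β)) (powScale 1 β * Fintype.card (Site 3 L)) (powScale (1 / 3) β) + coreEps1 L β (powScale (1 / 3) β) (9 * (L : ℝ) * (5 * (powScale (1 / 2) β * btLog β ^ 2)) + (powScale 1 β)) (min (1 / 40) (powScale (1 / 2) β * btLog β)) + coreEps2 L β (powScale (1 / 3) β) (9 * (L : ℝ) * (5 * (powScale (1 / 2) β * btLog β ^ 2)) + (powScale 1 β)) (min (1 / 40) (powScale (1 / 2) β * btLog β)) (powScale (1 / 3) β))) * (1 - η)) atTop (𝓝 (1 - 1 * (1 - η))) :=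
    tendsto_const_nhds.sub (e1.mul tendsto_const_nhds)
  have h2 : Tendsto (fun β : ℝ => Real.exp (coreEta L β (powScale (1 / 3) β) ((powScale (1 / 3) β) + (powScale (1 / 3) β)) (9 * (L : ℝ) * (5 * (powScale (1 / 2) β * btLog β ^ 2)) + (powScale 1 β)) (min (1 / 40) (powScale (1 / 2) β * btLog β)) (powScale 1 β * Fintype.card (Site 3 L)) (powScale (1 / 3) β) + coreEps1 L β (powScale (1 / 3) β) (9 * (L : ℝ) * (5 * (powScale (1 / 2) β * btLog β ^ 2)) + (powScale 1 β)) (min (1 / 40) (powScale (1 / 2) β * btLog β)) + coreEps2 L β (powScale (1 / 3) β) (9 * (L : ℝ) * (5 * (powScale (1 / 2) β * btLog β ^ 2)) + (powScale 1 β)) (min (1 / 40) (powScale (1 / 2) β * btLog β)) (powScale (1 / 3) β)) * (1 + η) - 1) atTop (𝓝 (1 * (1 + η) - 1)) :=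
    (e2.mul tendsto_const_nhds).sub tendsto_const_nhds
  have h := h1.max h2
  have hlim : max (1 - 1 * (1 - η)) (1 * (1 + η) - 1) < 2 * η := by
    rw [one_mul, one_mul]; rw [max_lt_iff]; constructor <;> linarith
  exact h.eventually (eventually_le_nhds hlim)

set_option maxHeartbeats 800000 in
-- explicit schedule-B profile, weight, window and transport exponent in the statement; the instantiation of
-- `core_transfer_defect_le_inner` exceeds the default budget.
/-- ★★★ **THE CORE DEFECT OF RECORD (schedule B).**  See the module docstring. [cite: Luscher1983, §3] -/
theorem core_defect_record (hL : Nonempty (NzSite L)) :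
    ∃ c₁ : ℝ → ℝ, ∀ η : ℝ, 0 < η → ∀ᶠ β : ℝ in atTop, 0 < c₁ β ∧ ∀ u' : GaugeConfig 3 1 SU2,
      (∀ k : Fin 3, ‖su2Quat (u' (0, k)) - 1‖ ≤ (powScale (1 / 3) β)) → (L : ℝ) ^ 3 * wilsonAction su2Rep u' ≤ (powScale (1 / 3) β) →
      ∀ v' : Edge 3 L → Fin 3 → ℝ, v' ∈ capBalancedSet L → (∀ e : Edge 3 L, ∑ a, v' e a ^ 2 ≤ (9 * (L : ℝ) * (5 * (powScale (1 / 2) β * btLog β ^ 2)) + (powScale 1 β)) ^ 2) → ‖linkEmbed L v'‖ ≤ (min (1 / 40) (powScale (1 / 2) β * btLog β)) / 12 →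
      ∀ φ : GaugeConfig 3 1 SU2 → ℝ, Measurable φ → ∀ Cφ : ℝ, (∀ u, |φ u| ≤ Cφ) →
      (∀ u, φ u ≠ 0 → (∀ k : Fin 3, ‖su2Quat (u (0, k)) - 1‖ ≤ (powScale (1 / 3) β)) ∧ (L : ℝ) ^ 3 * wilsonAction su2Rep u ≤ (powScale (1 / 3) β)) →
      |(∫ u, φ u * (∫ c, fpFibreTransfer L β (fun x : LinkSpace L => {x : LinkSpace L | linkCurry x ∈ capBalancedSet L}.indicator (fun _ => (1 : ℝ)) x * frozenProfile L (fun β' => stiffGaussExp L (β' / 2) β') (fun β' => min (1 / 40) (powScale (1 / 2) β' * btLog β')) β x) (coreWeight L (powScale 1 β) (5 * (powScale (1 / 2) β * btLog β ^ 2))) (gaugeTransform (fun _ : Site 3 L => c⁻¹) (orthoTube L u' v')) u ∂haarProbability SU2) ∂configMeasure SU2 1) - c₁ β * ((stiffGaussTop L (β / 2) β * Real.exp (-stiffGaussExp L (β / 2) β (linkEmbed L v'))) / (∫ u, ({u : GaugeConfig 3 1 SU2 | (∀ k : Fin 3, ‖su2Quat (u (0, k)) - 1‖ ≤ (powScale (1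 / 3) β)) ∧ (L : ℝ) ^ 3 * wilsonAction su2Rep u ≤ (powScale (1 / 3) β)}.indicator (fun _ => (1 : ℝ))) u * (transferKernel su2Rep ((L : ℝ) ^ 3 * β) (1 : GaugeConfig 3 1 SU2) u / transferKernel su2Rep ((L : ℝ) ^ 3 * β) (1 : GaugeConfig 3 1 SU2) 1)
            ∂configMeasure SU2 1)) * ∫ u, φ u * (avgKernel ((L : ℝ) ^ 3 * β) u' u / transferKernel su2Rep ((L : ℝ) ^ 3 * β) (1 : GaugeConfig 3 1 SU2) 1) ∂configMeasure SU2 1| ≤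
        2 * η * (c₁ β * ((stiffGaussTop L (β / 2) β * Real.exp (-stiffGaussExp L (β / 2) β (linkEmbed L v'))) / (∫ u, ({u : GaugeConfig 3 1 SU2 | (∀ k : Fin 3, ‖su2Quat (u (0, k)) - 1‖ ≤ (powScale (1 / 3) β)) ∧ (L : ℝ) ^ 3 * wilsonAction su2Rep u ≤ (powScale (1 / 3) β)}.indicator (fun _ => (1 : ℝ))) u * (transferKernel su2Rep ((L : ℝ) ^ 3 * β) (1 : GaugeConfig 3 1 SU2) u / transferKernel su2Rep ((L : ℝ) ^ 3 * β) (1 : GaugeConfig 3 1 SU2) 1)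
            ∂configMeasure SU2 1)) * ∫ u, |φ u| * (avgKernel ((L : ℝ) ^ 3 * β) u' u / transferKernel su2Rep ((L : ℝ) ^ 3 * β) (1 : GaugeConfig 3 1 SU2) 1) ∂configMeasure SU2 1) := by
  obtain ⟨c₁, hq⟩ := central_quasimode_record (L := L) hL
  refine ⟨c₁, fun η hη => ?_⟩
  have ea : ∀ᶠ β : ℝ in atTop, (powScale (1 / 3) β) ≤ 1 / 2 := (tendsto_powScale (σ := 1 / 3) (by norm_num)).eventually (eventually_le_nhds (by norm_num))
  have eT : ∀ᶠ β : ℝ in atTop, (9 * (L : ℝ) * (5 * (powScale (1 / 2) β * btLog β ^ 2)) + (powScale 1 β)) ≤ 1 / 30 := (tendsto_schedT (L := L)).eventually (eventually_le_nhds (by norm_num))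
  have e37 : ∀ᶠ β : ℝ in atTop, (min (1 / 40) (powScale (1 / 2) β * btLog β)) ≤ (9 * (L : ℝ) * (5 * (powScale (1 / 2) β * btLog β ^ 2)) + (powScale 1 β)) ∧ 3 * L * (5 * (powScale (1 / 2) β * btLog β ^ 2)) < 1 := by
    have h3 := eventually_mul_lt_of_tendsto (tendsto_powScale_mul_btLog_pow (p := 1 / 2) (by norm_num) 2) (3 * (L : ℝ) * 5) one_pos
    filter_upwards [h3] with β h
    refine ⟨rf_le_schedT (L := L) β, ?_⟩
    calc 3 * L * (5 * (powScale (1 / 2) β * btLog β ^ 2)) = (3 * (L : ℝ) * 5) * (powScale (1 / 2) β * btLog β ^ 2) := by ring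
      _ < 1 := h
  filter_upwards [hq η hη, ea, eT, e37, eventually_ge_atTop (1 : ℝ), eventually_defectFactor_le (L := L) hη] with β hQ ha hTs h37 hβ1 hF
  obtain ⟨hc₁, hC1⟩ := hQ
  refine ⟨hc₁, fun u' hu' hS' v' hv' hv'T hx' φ hφm Cφ hCφ hφw => ?_⟩
  have hβ : (0 : ℝ) ≤ β := by linarith
  have hβp : (0 : ℝ) < β := by linarith
  have hs1 : 0 < powScale 1 β := powScale_pos _ _
  have hℓ0 : 0 ≤ btLog β := le_trans zero_le_one (one_le_btLog β)
  have hx0 : 0 < powScale (1 / 2) β := powScale_pos _ _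
  have hT0 : 0 ≤ (9 * (L : ℝ) * (5 * (powScale (1 / 2) β * btLog β ^ 2)) + (powScale 1 β)) := by positivity
  -- the data
  have hqfm : ∀ β', Measurable ((fun β'' : ℝ => stiffGaussExp L (β'' / 2) β'') β') := fun β' => measurable_stiffGaussExp _ _
  have hqf0 : ∀ β' x, 0 ≤ (fun β'' : ℝ => stiffGaussExp L (β'' / 2) β'') β' x := fun β' x => stiffGaussExp_nonneg _ _ x
  have hΩGm : Measurable (frozenProfile L (fun β' => stiffGaussExp L (β' / 2) β') (fun β' => min (1 / 40) (powScale (1 / 2) β' * btLog β')) β) :=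
    measurable_frozenProfile hqfm _ β
  have hΩG0 : ∀ x, 0 ≤ frozenProfile L (fun β' => stiffGaussExp L (β' / 2) β') (fun β' => min (1 / 40) (powScale (1 / 2) β' * btLog β')) β x :=
    fun x => (frozenProfile_mem_Icc hqf0 _ β x).1
  have hΩG1 : ∀ x, |frozenProfile L (fun β' => stiffGaussExp L (β' / 2) β') (fun β' => min (1 / 40) (powScale (1 / 2) β' * btLog β')) β x| ≤ 1 :=
    abs_frozenProfile_le hqf0 _ β
  have hΩm := measurable_capRestrict (L := L) hΩGm
  have hΩdat := fun x => capRestrict_mem (L := L) hΩG0 hΩG1 x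
  have hWc := fun g (hg : coreWeight L (powScale 1 β) (5 * (powScale (1 / 2) β * btLog β ^ 2)) g ≠ 0) => coreWeight_support (L := L) hs1.le h37.2 hg
  have hΩt : ∀ v : Edge 3 L → Fin 3 → ℝ, (fun x : LinkSpace L => {x : LinkSpace L | linkCurry x ∈ capBalancedSet L}.indicator (fun _ => (1 : ℝ)) x * frozenProfile L (fun β' => stiffGaussExp L (β' / 2) β') (fun β' => min (1 / 40) (powScale (1 / 2) β' * btLog β')) β x) (linkEmbed L v) ≠ 0 →
      v ∈ capBalancedSet L ∧ (∀ (e : Edge 3 L) (c : Fin 3), |v e c| ≤ (9 * (L : ℝ) * (5 * (powScale (1 / 2) β * btLog β ^ 2)) + (powScale 1 β))) ∧ ‖linkEmbed L v‖ ≤ (min (1 / 40) (powScale (1 / 2) β * btLog β)) := fun v hv => by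
    obtain ⟨hcap, hvc, hvn⟩ := capRestrict_frozenProfile_support (L := L) _ _ β v hv
    exact ⟨hcap, fun e c => (hvc e c).trans h37.1, hvn⟩
  have hPinv : ∀ (g : SU2) (x : LinkSpace L), (fun x : LinkSpace L => (stiffGaussTop L (β / 2) β * Real.exp (-stiffGaussExp L (β / 2) β x)) / (∫ u, ({u : GaugeConfig 3 1 SU2 | (∀ k : Fin 3, ‖su2Quat (u (0, k)) - 1‖ ≤ (powScale (1 / 3) β)) ∧ (L : ℝ) ^ 3 * wilsonAction su2Rep u ≤ (powScale (1 / 3) β)}.indicator (fun _ => (1 : ℝ))) u * (transferKernel su2Rep ((L : ℝ) ^ 3 * β) (1 : GaugeConfig 3 1 SU2) u / transferKernel su2Rep ((L : ℝ) ^ 3 * β) (1 : GaugeConfig 3 1 SU2) 1)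
            ∂configMeasure SU2 1)) (adL L g x) = (fun x : LinkSpace L => (stiffGaussTop L (β / 2) β * Real.exp (-stiffGaussExp L (β / 2) β x)) / (∫ u, ({u : GaugeConfig 3 1 SU2 | (∀ k : Fin 3, ‖su2Quat (u (0, k)) - 1‖ ≤ (powScale (1 / 3) β)) ∧ (L : ℝ) ^ 3 * wilsonAction su2Rep u ≤ (powScale (1 / 3) β)}.indicator (fun _ => (1 : ℝ))) u * (transferKernel su2Rep ((L : ℝ) ^ 3 * β) (1 : GaugeConfig 3 1 SU2) u / transferKernel su2Rep ((L : ℝ) ^ 3 * β) (1 : GaugeConfig 3 1 SU2) 1)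
            ∂configMeasure SU2 1)) x := fun g x => by
    simp only [stiffGaussExp_adL]
  obtain ⟨hSlo, -⟩ := stiffGaussTop_record_bounds (L := L) hβp
  have hS : 0 < stiffGaussTop L (β / 2) β := lt_of_lt_of_le (pow_pos (Real.sqrt_pos.2 (by positivity)) _) hSlo
  have hI0 := slowWindow_I0_pos (L := L) (powScale_pos (1 / 3) β) (powScale_pos (1 / 3) β) ((L : ℝ) ^ 3 * β)
  have hP0 : ∀ x : LinkSpace L, 0 ≤ (fun x : LinkSpace L => (stiffGaussTop L (β / 2) β * Real.exp (-stiffGaussExp L (β / 2) β x)) / (∫ u, ({u : GaugeConfig 3 1 SU2 | (∀ k : Fin 3, ‖su2Quat (u (0, k)) - 1‖ ≤ (powScale (1 / 3) β)) ∧ (L : ℝ) ^ 3 * wilsonAction su2Rep u ≤ (powScale (1 / 3) β)}.indicator (fun _ => (1 : ℝ))) u * (transferKernel su2Rep ((L : ℝ) ^ 3 * β) (1 : GaugeConfig 3 1 SU2) u / transferKernel su2Rep ((L : ℝ) ^ 3 * β) (1 : GaugeConfig 3 1 SU2) 1)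
            ∂configMeasure SU2 1)) x := fun x => by positivity
  have hrf0 : 0 ≤ (min (1 / 40) (powScale (1 / 2) β * btLog β)) := le_min (by norm_num) (mul_nonneg hx0.le hℓ0)
  have hmain := core_transfer_defect_le_inner (L := L) hβ hΩm (fun x => (hΩdat x).2.2) (fun x => (hΩdat x).1) (measurable_coreWeight (L := L) _ _)
    (abs_coreWeight_le (L := L) _ _) (fun g => (coreWeight_mem_Icc (L := L) _ _ g).1) ha (by linarith) hT0 hTs (lt_of_le_of_lt ha (by norm_num)) hΩt hWc
    (P := (fun x : LinkSpace L => (stiffGaussTop L (β / 2) β * Real.exp (-stiffGaussExp L (β / 2) β x)) / (∫ u, ({u : GaugeConfig 3 1 SU2 | (∀ k : Fin 3, ‖su2Quat (u (0, k)) - 1‖ ≤ (powScale (1 / 3) β)) ∧ (L : ℝ) ^ 3 * wilsonAction su2Rep u ≤ (powScale (1 / 3) β)}.indicator (fun _ => (1 : ℝ))) u * (transferKernel su2Rep ((L : ℝ) ^ 3 * β) (1 : GaugeConfig 3 1 SU2) u / transferKernel su2Rep ((L : ℝ) ^ 3 * β) (1 : GaugeConfig 3 1 SU2) 1)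
            ∂configMeasure SU2 1))) hP0 hPinv hc₁.le (by linarith [hrf0]) hC1 u' hu' hS' hv' hv'T hx' hφm hCφ hφw
  refine hmain.trans ?_
  have hK1 : 0 < transferKernel su2Rep ((L : ℝ) ^ 3 * β) (1 : GaugeConfig 3 1 SU2) 1 := transferKernel_pos _ _ _ _
  have hint : 0 ≤ ∫ u, |φ u| * (avgKernel ((L : ℝ) ^ 3 * β) u' u / transferKernel su2Rep ((L : ℝ) ^ 3 * β) (1 : GaugeConfig 3 1 SU2) 1) ∂configMeasure SU2 1 :=
    integral_nonneg fun u => mul_nonneg (abs_nonneg _) (div_nonneg (avgKernel_pos _ _ _).le hK1.le)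
  have hA0 : 0 ≤ c₁ β * ((stiffGaussTop L (β / 2) β * Real.exp (-stiffGaussExp L (β / 2) β (linkEmbed L v'))) / (∫ u, ({u : GaugeConfig 3 1 SU2 | (∀ k : Fin 3, ‖su2Quat (u (0, k)) - 1‖ ≤ (powScale (1 / 3) β)) ∧ (L : ℝ) ^ 3 * wilsonAction su2Rep u ≤ (powScale (1 / 3) β)}.indicator (fun _ => (1 : ℝ))) u * (transferKernel su2Rep ((L : ℝ) ^ 3 * β) (1 : GaugeConfig 3 1 SU2) u / transferKernel su2Rep ((L : ℝ) ^ 3 * β) (1 : GaugeConfig 3 1 SU2) 1)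
            ∂configMeasure SU2 1)) * ∫ u, |φ u| * (avgKernel ((L : ℝ) ^ 3 * β) u' u / transferKernel su2Rep ((L : ℝ) ^ 3 * β) (1 : GaugeConfig 3 1 SU2) 1) ∂configMeasure SU2 1 := by
    have := hP0 (linkEmbed L v')
    exact mul_nonneg (mul_nonneg hc₁.le this) hint
  exact mul_le_mul_of_nonneg_right hF hA0

end Summit.QuantumFields.YangMills.Theorems.FemtoTransferGap.TwoLattice.ConstTube
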